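import Literature.IUT.LogVolume.TameQuadraticIsometryGaloisOrder
import Literature.IUT.LogVolume.TensorPacketLemmas
import HarnessLib

/-!
# The tame quadratic field `K = ℚ_p(π)`, `π² = p`: Galois conjugation, value group, and ONE SLOT of a packet `⊗_{i∈I} K`

Classical local algebra (nothing disputed; the [IUTchIV] locator records where the abc-iut cell uses it).  Toolkit for
`TameQuadraticPacketIsometryStable.lean` (factorwise `ℚ_p`-linear isometries fix the maximal order `(R_I)^∼` of EVERY packet
`⊗_{i∈I} K`, `p` odd — the all-label sequel to the two-factor file `TameQuadraticIsometryStable.lean`):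

* **`exists_conj`** — the GALOIS CONJUGATION `τ : π ↦ −π` (abc-iut-E-t52's `TameQuadratic.conj`, p462786) repackaged as a
  multiplicative, ISOMETRIC `ℚ_p`-linear self-equivalence of `K` (`[K : ℚ_p] = 2`; the norm statement is the new clause);
* `padicNorm_le_one_of_mul_norm_pi_le`, `exists_eq_p_mul_of_norm_le_norm_pi` — the value group of `ℚ_p` against
  `‖π‖ = p^{−1/2}`: `‖b‖‖π‖ ≤ 1 ⇒ b ∈ ℤ_p`, `‖c‖ ≤ ‖π‖ ⇒ c ∈ p·ℤ_p`;
* one slot `i₀` of `V = ⊗_{i∈I} K` (any index type): `congr_update_purePacket`, `iota_mul_purePacket_eq_update`,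
  `purePacket_update_combo`; the ACTION of a `ℚ_p`-linear `σ` placed at `i₀` on the span `L_{i₀}` of the pure tensors with
  `1` at `i₀` and on `ι_{i₀}(π)·L_{i₀}` (`congr_update_of_mem_span`, `congr_update_iota_mul_of_mem_span`: `σ 1 = a + bπ`,
  `σ π = c + dπ` act as `m ↦ a·m + b·ι(π)m`, `ι(π)m ↦ c·m + d·ι(π)m`); **`exists_decomp`** — `V = L_{i₀} + ι_{i₀}(π)·L_{i₀}`.

Proof-only file (theorems, no definitions). [cite: NeukirchANT1999, Ch. II (5.5)] [cite: Mochizuki2012, IUTchIV Prop. 1.1 p. 9]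
-/

noncomputable section

open Metric Set Function
open scoped TensorProduct

namespace Literature.IUT.LogVolume

namespace TameQuadratic

variable {p : ℕ} [Fact p.Prime]
variable {K : Type} [NontriviallyNormedField K] [NormedAlgebra ℚ_[p] K] {π : K}

/-! ## The Galois conjugation `π ↦ −π` and the value group of `ℚ_p` -/

/-- **The Galois conjugation** of `K = ℚ_p(π)` (`[K : ℚ_p] = 2`, `π² = p`): a `ℚ_p`-linear self-equivalence `τ` with `τ 1 = 1`,
`τ π = −π`, MULTIPLICATIVE and ISOMETRIC (`τ(a + bπ) = a − bπ`). [cite: NeukirchANT1999, Ch. II (5.5)] -/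
theorem exists_conj [IsUltrametricDist K] (hK : Module.finrank ℚ_[p] K = 2) (hπ : π ^ 2 = (p : K)) :
    ∃ τ : K ≃ₗ[ℚ_[p]] K, τ 1 = 1 ∧ τ π = -π ∧ (∀ x y, τ (x * y) = τ x * τ y) ∧ ∀ x, ‖τ x‖ = ‖x‖ := by
  obtain ⟨B, hB0, hB1⟩ := exists_basis hK hπ
  refine ⟨(conj hK hπ).toLinearEquiv, ?_, ?_, fun x y => ?_, fun x => ?_⟩
  · show conj hK hπ 1 = 1
    exact map_one _
  · show conj hK hπ π = -π
    exact conj_pi hK hπ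
  · show conj hK hπ (x * y) = conj hK hπ x * conj hK hπ y
    exact map_mul _ x y
  · show ‖conj hK hπ x‖ = ‖x‖
    conv_lhs => rw [← combo_repr B hB0 hB1 x]
    rw [conj_combo, norm_combo hπ, norm_neg, ← norm_eq_max B hπ hB0 hB1 x]

/-- Value group: `‖b‖·‖π‖ ≤ 1 ⇒ ‖b‖ ≤ 1` for `b ∈ ℚ_p` (`‖b‖ ∈ p^ℤ`, `‖π‖ = p^{−1/2}`). [cite: NeukirchANT1999, Ch. II (5.5)] -/
theorem padicNorm_le_one_of_mul_norm_pi_le (hπ : π ^ 2 = (p : K)) {b : ℚ_[p]} (h : ‖b‖ * ‖π‖ ≤ 1) : ‖b‖ ≤ 1 := by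
  have hp1 : (1 : ℝ) < p := by exact_mod_cast (Fact.out : p.Prime).one_lt
  have hπ1 := norm_pi_lt_one hπ
  have hπ0 := norm_pi_pos hπ
  have hb : ‖b‖ < (p : ℝ) ^ ((0 : ℤ) + 1) := by
    rw [zero_add, zpow_one]
    by_contra hle
    push Not at hle
    have h2 : ‖b‖ ^ 2 * ‖π‖ ^ 2 ≤ 1 := by
      rw [← mul_pow]; exact pow_le_one₀ (mul_nonneg (norm_nonneg _) (norm_nonneg _)) h
    rw [norm_pi_sq hπ] at h2
    have h3 : (p : ℝ) ^ 2 * (p : ℝ)⁻¹ ≤ ‖b‖ ^ 2 * (p : ℝ)⁻¹ := by gcongr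
    have h4 : (p : ℝ) ^ 2 * (p : ℝ)⁻¹ = p := by field_simp
    linarith [h3.trans h2]
  have := (Padic.norm_le_pow_iff_norm_lt_pow_add_one b 0).mpr hb
  rwa [zpow_zero] at this

/-- Value group: `‖c‖ ≤ ‖π‖ ⇒ c ∈ p·ℤ_p`, i.e. `c = p·c'` with `‖c'‖ ≤ 1`. [cite: NeukirchANT1999, Ch. II (5.5)] -/
theorem exists_eq_p_mul_of_norm_le_norm_pi (hπ : π ^ 2 = (p : K)) {c : ℚ_[p]} (h : ‖c‖ ≤ ‖π‖) :
    ∃ c' : ℚ_[p], ‖c'‖ ≤ 1 ∧ c = (p : ℚ_[p]) * c' := by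
  have hp0 : (p : ℚ_[p]) ≠ 0 := Nat.cast_ne_zero.mpr (Fact.out : p.Prime).ne_zero
  have hp1 : (1 : ℝ) < p := by exact_mod_cast (Fact.out : p.Prime).one_lt
  refine ⟨(p : ℚ_[p])⁻¹ * c, ?_, by rw [mul_inv_cancel_left₀ hp0]⟩
  have hc : ‖c‖ < (p : ℝ) ^ ((-1 : ℤ) + 1) := by
    rw [show (-1 : ℤ) + 1 = 0 by norm_num, zpow_zero]
    exact h.trans_lt (norm_pi_lt_one hπ)
  have hc' := (Padic.norm_le_pow_iff_norm_lt_pow_add_one c (-1)).mpr hc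
  rw [norm_mul, norm_inv, Padic.norm_p, inv_inv, zpow_neg_one] at *
  calc (p : ℝ) * ‖c‖ ≤ (p : ℝ) * (p : ℝ)⁻¹ := by gcongr
    _ = 1 := mul_inv_cancel₀ (by positivity)

/-! ## One slot `i₀` of the packet `⊗_{i∈I} K`: generators, the span `L_{i₀}`, and the action of `σ` at `i₀` -/

variable {I : Type} [DecidableEq I]

/-- `(⊗ g)(⊗ x) = ⊗ (update x i₀ (σ (x i₀)))` for the single-slot family `g = update 1 i₀ σ`. [cite: Mochizuki2012, IUTchIV Prop. 1.1 p. 9] -/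
theorem congr_update_purePacket (i₀ : I) (σ : K ≃ₗ[ℚ_[p]] K) (x : I → K) :
    (PiTensorProduct.congr (update (fun _ : I => LinearEquiv.refl ℚ_[p] K) i₀ σ) :
        PacketAlgebra p (fun _ : I => K) ≃ₗ[ℚ_[p]] PacketAlgebra p (fun _ : I => K)) (purePacket p (fun _ : I => K) x) =
      purePacket p (fun _ : I => K) (update x i₀ (σ (x i₀))) := by
  rw [purePacket, purePacket, PiTensorProduct.congr_tprod]
  congr 1
  funext i
  by_cases h : i = i₀
  · subst h; rw [update_self, update_self]
  · rw [update_of_ne h, update_of_ne h]; rfl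

/-- `ι_{i₀}(y)·⊗ x = ⊗ (update x i₀ (y·x_{i₀}))`. [cite: Mochizuki2012, IUTchIV Prop. 1.1 p. 9] -/
theorem iota_mul_purePacket_eq_update (i₀ : I) (y : K) (x : I → K) :
    iota p (fun _ : I => K) i₀ y * purePacket p (fun _ : I => K) x =
      purePacket p (fun _ : I => K) (update x i₀ (y * x i₀)) := by
  rw [iota_eq_purePacket, purePacket_mul]
  congr 1
  funext i
  by_cases h : i = i₀
  · subst h; rw [Pi.mul_apply, Pi.mulSingle_eq_same, update_self]
  · rw [Pi.mul_apply, Pi.mulSingle_eq_of_ne h, one_mul, update_of_ne h]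

/-- Multilinearity at the slot `i₀`: `⊗ (update x i₀ (a·1 + b·π)) = a·⊗(update x i₀ 1) + b·⊗(update x i₀ π)`.
[cite: Mochizuki2012, IUTchIV Prop. 1.1 p. 9] -/
theorem purePacket_update_combo (i₀ : I) (x : I → K) (a b : ℚ_[p]) :
    purePacket p (fun _ : I => K) (update x i₀ (a • (1 : K) + b • π)) =
      a • purePacket p (fun _ : I => K) (update x i₀ 1) + b • purePacket p (fun _ : I => K) (update x i₀ π) := by
  simp only [purePacket]
  rw [MultilinearMap.map_update_add, MultilinearMap.map_update_smul, MultilinearMap.map_update_smul]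

/-- **Action of `σ` at the slot `i₀` on `L_{i₀}`** (the span of the pure tensors with `1` at `i₀`): with `σ 1 = a + bπ`,
`(⊗ g)(m) = a·m + b·ι_{i₀}(π)·m`. [cite: Mochizuki2012, IUTchIV Prop. 1.1 p. 9] -/
theorem congr_update_of_mem_span (B : Module.Basis (Fin 2) ℚ_[p] K) (hB0 : B 0 = 1) (hB1 : B 1 = π) (i₀ : I)
    (σ : K ≃ₗ[ℚ_[p]] K) {m : PacketAlgebra p (fun _ : I => K)}
    (hm : m ∈ Submodule.span ℚ_[p]
      {t : PacketAlgebra p (fun _ : I => K) | ∃ x : I → K, x i₀ = 1 ∧ t = purePacket p (fun _ : I => K) x}) :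
    (PiTensorProduct.congr (update (fun _ : I => LinearEquiv.refl ℚ_[p] K) i₀ σ) :
        PacketAlgebra p (fun _ : I => K) ≃ₗ[ℚ_[p]] PacketAlgebra p (fun _ : I => K)) m =
      B.repr (σ 1) 0 • m + B.repr (σ 1) 1 • (iota p (fun _ : I => K) i₀ π * m) := by
  induction hm using Submodule.span_induction with
  | mem t ht =>
    obtain ⟨x, hx, rfl⟩ := ht
    have hx1 : update x i₀ (1 : K) = x := by rw [← hx]; exact update_eq_self i₀ x
    rw [congr_update_purePacket, hx, iota_mul_purePacket_eq_update, hx, mul_one]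
    conv_lhs => rw [← combo_repr B hB0 hB1 (σ 1), purePacket_update_combo, hx1]
  | zero => rw [map_zero, mul_zero, smul_zero, smul_zero, add_zero]
  | add x y _ _ hx hy => rw [map_add, hx, hy, mul_add, smul_add, smul_add]; abel
  | smul r x _ hx => rw [map_smul, hx, mul_smul_comm, smul_add, smul_comm r (B.repr (σ 1) 0), smul_comm r (B.repr (σ 1) 1)]

/-- **Action of `σ` at the slot `i₀` on `ι_{i₀}(π)·L_{i₀}`**: with `σ π = c + dπ`, `(⊗ g)(ι_{i₀}(π)·m) = c·m + d·ι_{i₀}(π)·m`.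
[cite: Mochizuki2012, IUTchIV Prop. 1.1 p. 9] -/
theorem congr_update_iota_mul_of_mem_span (B : Module.Basis (Fin 2) ℚ_[p] K) (hB0 : B 0 = 1) (hB1 : B 1 = π) (i₀ : I)
    (σ : K ≃ₗ[ℚ_[p]] K) {m : PacketAlgebra p (fun _ : I => K)}
    (hm : m ∈ Submodule.span ℚ_[p]
      {t : PacketAlgebra p (fun _ : I => K) | ∃ x : I → K, x i₀ = 1 ∧ t = purePacket p (fun _ : I => K) x}) :
    (PiTensorProduct.congr (update (fun _ : I => LinearEquiv.refl ℚ_[p] K) i₀ σ) :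
        PacketAlgebra p (fun _ : I => K) ≃ₗ[ℚ_[p]] PacketAlgebra p (fun _ : I => K)) (iota p (fun _ : I => K) i₀ π * m) =
      B.repr (σ π) 0 • m + B.repr (σ π) 1 • (iota p (fun _ : I => K) i₀ π * m) := by
  induction hm using Submodule.span_induction with
  | mem t ht =>
    obtain ⟨x, hx, rfl⟩ := ht
    have hx1 : update x i₀ (1 : K) = x := by rw [← hx]; exact update_eq_self i₀ x
    rw [iota_mul_purePacket_eq_update, hx, mul_one]
    conv_lhs => rw [congr_update_purePacket, update_self, update_idem, ← combo_repr B hB0 hB1 (σ π),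
      purePacket_update_combo, hx1]
  | zero => rw [mul_zero, map_zero, smul_zero, smul_zero, add_zero]
  | add x y _ _ hx hy => rw [mul_add, map_add, hx, hy, smul_add, smul_add]; abel
  | smul r x _ hx =>
    rw [mul_smul_comm, map_smul, hx, smul_add, smul_comm r (B.repr (σ π) 0), smul_comm r (B.repr (σ π) 1)]

/-- **Every `z ∈ ⊗_{i∈I} K` is `m₀ + ι_{i₀}(π)·m₁` with `m₀, m₁ ∈ L_{i₀}`** (expand the slot `i₀` in the basis `(1, π)`).
[cite: Mochizuki2012, IUTchIV Prop. 1.1 p. 9] -/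
theorem exists_decomp (B : Module.Basis (Fin 2) ℚ_[p] K) (hB0 : B 0 = 1) (hB1 : B 1 = π) (i₀ : I)
    (z : PacketAlgebra p (fun _ : I => K)) :
    ∃ m₀ m₁ : PacketAlgebra p (fun _ : I => K),
      m₀ ∈ Submodule.span ℚ_[p]
        {t : PacketAlgebra p (fun _ : I => K) | ∃ x : I → K, x i₀ = 1 ∧ t = purePacket p (fun _ : I => K) x} ∧
      m₁ ∈ Submodule.span ℚ_[p]
        {t : PacketAlgebra p (fun _ : I => K) | ∃ x : I → K, x i₀ = 1 ∧ t = purePacket p (fun _ : I => K) x} ∧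
      z = m₀ + iota p (fun _ : I => K) i₀ π * m₁ := by
  induction z using PiTensorProduct.induction_on with
  | smul_tprod r f =>
    have hP : purePacket p (fun _ : I => K) (update f i₀ 1) ∈ Submodule.span ℚ_[p]
        {t : PacketAlgebra p (fun _ : I => K) | ∃ x : I → K, x i₀ = 1 ∧ t = purePacket p (fun _ : I => K) x} :=
      Submodule.subset_span ⟨update f i₀ 1, update_self .., rfl⟩
    refine ⟨r • (B.repr (f i₀) 0 • purePacket p (fun _ : I => K) (update f i₀ 1)),
      r • (B.repr (f i₀) 1 • purePacket p (fun _ : I => K) (update f i₀ 1)),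
      Submodule.smul_mem _ _ (Submodule.smul_mem _ _ hP), Submodule.smul_mem _ _ (Submodule.smul_mem _ _ hP), ?_⟩
    have hf : PiTensorProduct.tprod ℚ_[p] f = purePacket p (fun _ : I => K) (update f i₀ (f i₀)) := by
      rw [update_eq_self]; rfl
    rw [hf]
    conv_lhs => rw [← combo_repr B hB0 hB1 (f i₀), purePacket_update_combo, smul_add]
    rw [mul_smul_comm, mul_smul_comm, iota_mul_purePacket_eq_update, update_self, mul_one, update_idem]
  | add x y hx hy =>
    obtain ⟨m₀, m₁, hm₀, hm₁, rfl⟩ := hx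
    obtain ⟨n₀, n₁, hn₀, hn₁, rfl⟩ := hy
    exact ⟨m₀ + n₀, m₁ + n₁, Submodule.add_mem _ hm₀ hn₀, Submodule.add_mem _ hm₁ hn₁, by rw [mul_add]; abel⟩

end TameQuadratic

end Literature.IUT.LogVolume

end
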